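import Literature.NumberTheory.EllipticCurves.Rank1Residual.Predicates
import Literature.NumberTheory.EllipticCurves.IwasawaSelmer
import Literature.NumberTheory.EllipticCurves.PAdicLFunction
import Literature.NumberTheory.EllipticCurves.NonEisensteinPrimeOfSurjective
import Literature.NumberTheory.EllipticCurves.Kato2004.EulerSystemBoundFineSelmerTwo
import HarnessLib

/-!
# Route ByReductionTypeAtTwo, crux `OrdKatoHalfAtTwoIso` (stmt-BirchSwinnertonDyer-19573), line `steinberg-fibre-at-two` —
# route-posited statements G11⁻ (GREENBERG'S CONJECTURE 1.11 AT `p = 2` on the `Δ < 0` cell) and MU13⁻ (the `μ`-INVARIANT OF THE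
# ZETA QUOTIENT `𝐇¹_Γ(T₂W) ⧸ Λ𝐳` VANISHES for some GENUINE `2`-adic Euler-system class `𝐳`) — definitions only

Seat `cruxlead-stmt-BirchSwinnertonDyer-19573-w3` g7 (prover WIDTH under the LEAD `cruxlead-19573` g10; `--supports` stmt-BirchSwinnertonDyer-24097).
The two statements are the halves of a LOSSLESS SPLIT of the registered memo stub V♭⁻ = `stub_muFreeValue_negDisc_two` of skeleton v24
(«every NORMALISED ordinary-kernel functional takes a value `∉ (2)` at `loc₂ g` of some GENUINE Euler-system class `g`», `Δ < 0` cell):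
V♭⁻ ⟺ G11⁻ ∧ MU13⁻ in the kernel modulo print (sibling doors file `…OrdKatoHalfAtTwoIsoMuFreeValueNegOfGreenbergMu.lean`:
⇐ from the Poitou–Tate exactness fact p729889 + PUB; ⇒ G11⁻ through F1μι⁻ and the PROVED core Theorem A at `2` on `Δ < 0`; ⇒ MU13⁻ from
Kato Thm. 12.4 (2)). The `0 < Δ` twin G11⁺ is `GreenbergMuZeroTwoOrdPosDisc` (w3 g6, p733065, registered stub of v24).

HONEST FRAMING (cell bsd-2adic): `Prop`-valued DEFINITIONS with bodies, tagged `@[conjecture]` — OPEN statements DISPLAYED so that the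
skeleton and its doors can name them; nothing is asserted, no `sorry`, no instance, no axiom; NOT Literature facts (an unproven conjecture /
a memo reading is not a fact); BSD is not proved by any of this.

* G11⁻ `GreenbergMuZeroTwoOrdNegDisc`: Greenberg's Conjecture 1.11 ([GreenbergLNM1716, §1 p. 64]: «Assume that `Sel_E(ℚ_∞)_p` is
  `Λ`-cotorsion. … In particular, if `E[p]` is irreducible … then `μ_E = 0`» — no restriction on `p`, the book's §5 treats `p = 2`; Greenberg's
  Selmer group is strict at the archimedean place, pp. 106–107 = the tree's `selmerGroupOver`) READ AT `p = 2` on the cell [good ordinary at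
  `2`, `ρ̄_{W,2}` onto (so `E[2]` irreducible), `Δ_W < 0`], for normalised cyclotomic data and EVERY Selmer dual datum: `μ(X(W/ℚ_∞)) = D.mu = 0`.
  RANK-FREE and CM-free, like V♭⁻ and Greenberg's text (cotorsion is NOT a binder: it is Kato 17.4 (1) at `2` for every `E/ℚ` good ordinary at
  `2` — PUB, `kato_divisibility_allPrimes`, rank-free — used inside the doors). NECESSARY for the crux on the habitat (non-CM, analytic rank `0`):
  the lead g10's sign-free display `greenbergMu_two_onto_necessary` (Lines/steinberg_fibre_at_two.lean §4), mod PUB + Cassels + Abbes–Ullmo.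
* MU13⁻ `ZetaQuotientMuZeroTwoOrdNegDisc`: on the same cell, for normalised cyclotomic `(κ, γ)` and EVERY pinned carrier `I = 𝐇¹_Γ(T₂W)`:
  some GENUINE `2`-adic Euler-system class `z ∈ 𝐇¹_Γ` (`IsEulerSystemClassTwo`) has `𝐇¹_Γ ⧸ Λz` finitely generated over `ℤ₂` — i.e.
  `μ(𝐇¹_Γ/Λz) = 0` (the quotient is `Λ`-torsion, `𝐇¹_Γ` being torsion-free of rank `1`, Kato Thm. 12.4 (2)). This is the `μ`-part of the term
  `𝐇¹(T)/Z(f,T)` in Kato's §17.13 identity `ℓ_𝔭(X) − ℓ_𝔭(Λ/(L_p)) = ℓ_𝔭(𝐇²) − ℓ_𝔭(𝐇¹/Z)` (p. 280; printed for `𝔭 = (p)` only when `p ≠ 2` under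
  (12.5.2)); a statement INTERNAL to Kato's Euler system in Iwasawa cohomology — no Coleman map, no Tate pairing, no `p`-adic `L`-function, no
  functional. MEMO tier (a reading of Kato §§12–17 at `2`: under the line's memo reading «Prop. 17.11 at `2` `μ`-sharp + the explicit reciprocity
  law 16.6 (2) at `2`» it follows from the PROVED analytic `μ₂ = 0` on the onto locus, since `μ(col(loc z_γ)) = μ(coarse) + μ(𝐇¹/Λz_γ)`); it
  is the EXACT excess of V♭⁻ over G11⁻ (doors file), and its first visible test is the lead's F-27a / the Negative lemma p691215 («every genuine
  class `2`-divisible ⇒ V♭ fails»: MU13⁻ ⇒ some genuine class is not in `2·𝐇¹_Γ` once `𝐇¹_Γ ≠ 0`). Not in print as stated at `p = 2`; nothing asserted.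

* N2D⁻ `ZetaNotTwoDivisibleTwoOrdNegDisc` (appended, g7): on the same cell, ∀ pinned `I`, some GENUINE class `z ∉ (2)·𝐇¹_Γ` — the negation of
  the Negative lemma p691215's divisibility hypothesis; kernel-EQUIVALENT to MU13⁻ modulo Kato 12.4 (2) (rank) once `𝐇¹_Γ(T₂W)` is known to be
  Λ-free for irreducible `W[2]` (Kato 12.4 (3) at `p = 2`, now a tree theorem: `Kato2004/IwasawaH1FreeOfNoRationalTorsionProofs`). MEMO tier.

References: [GreenbergLNM1716] Conj. 1.11 (p. 64), pp. 106–107; [Kato2004Asterisque] Thm. 12.4 (2) (p. 221), Thm. 12.5 (4) (p. 222), §13.1 (13.1.1),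
Thm. 13.4 (p. 226), Thm. 17.4 (p. 273), Prop. 17.11 (p. 277), §17.13 (pp. 279–280); tree `…GreenbergMuDefs` (G11⁺), `…ColemanMuFreeValue`
(V ⟺ W2), `Kato2004/EulerSystemBoundFineSelmerTwo` (`IsEulerSystemClassTwo`), `Kato2004/IwasawaH1ZetaQuotientMuProofs` (w3 g7, the algebra).
-/

set_option autoImplicit false
set_option linter.dupNamespace false

noncomputable section

open scoped Classical MatrixGroups ModularForm NumberField
open CongruenceSubgroup WeierstrassCurve Field IsDedekindDomain NumberField
open Literature.NumberTheory.GaloisRepresentations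
open Literature.NumberTheory.EllipticCurves Literature.NumberTheory.EllipticCurves.ModularForms
open Literature.NumberTheory.EllipticCurves.Rank1Residual
open Literature.NumberTheory.EllipticCurves.Kato2004 Literature.NumberTheory.EllipticCurves.Kato2004.EulerSystemValues

namespace Summit.BirchSwinnertonDyer.BirchSwinnertonDyer.Theorems.SteinbergFibreAtTwo

/-- [PUBLISHED CONJECTURE, OPEN] **G11⁻ — Greenberg's Conjecture 1.11 at `p = 2` on the `Δ < 0` cell of crux 202.**
For every globally minimal `W/ℚ` good ordinary at `2`, with `ρ̄_{W,2}` onto (`E[2]` irreducible) and `Δ_W < 0`; for every cyclotomic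
`ℤ₂`-extension `κ` with a normalised topological generator `γ` matching the cyclotomic variable, and every Selmer dual datum `D`
(`X(W/ℚ_∞) = D.X`): `μ(X(W/ℚ_∞)) = 0` (`D.mu = 0`). Greenberg LNM 1716 Conj. 1.11 (p. 64) read at `p = 2` (no parity restriction in print;
`Sel` cotorsion on this cell by Kato 17.4 (1) at `2`, PUB — so no cotorsion binder); RANK-FREE and CM-free, the `Δ < 0` twin of w3 g6's G11⁺
`GreenbergMuZeroTwoOrdPosDisc` without the habitat binders; an OPEN published conjecture — nothing asserted.
[cite: GreenbergLNM1716, Conj. 1.11 (p. 64)] [cite: Kato2004Asterisque, Thm. 17.4 (1) (p. 273)] -/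
@[conjecture] def GreenbergMuZeroTwoOrdNegDisc : Prop :=
  ∀ (W : WeierstrassCurve ℚ) [W.IsElliptic] [W.IsGloballyMinimal],
    GoodOrd W 2 → W.HasSurjectiveModNGaloisRep 2 → W.Δ < 0 →
    ∀ (κ : ZpExtension ℚ 2) (γ : absoluteGaloisGroup ℚ), κ.IsCyclotomic → κ.IsTopGenerator γ → IsCyclotomicVariable 2 γ →
      ∀ D : W.SelmerDualData κ γ, D.mu = 0

/-- `GreenbergMuZeroTwoOrdNegDisc` unfolds to its displayed body. [folklore] -/
theorem greenbergMuZeroTwoOrdNegDisc_iff : GreenbergMuZeroTwoOrdNegDisc ↔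
    ∀ (W : WeierstrassCurve ℚ) [W.IsElliptic] [W.IsGloballyMinimal],
    GoodOrd W 2 → W.HasSurjectiveModNGaloisRep 2 → W.Δ < 0 →
    ∀ (κ : ZpExtension ℚ 2) (γ : absoluteGaloisGroup ℚ), κ.IsCyclotomic → κ.IsTopGenerator γ → IsCyclotomicVariable 2 γ →
      ∀ D : W.SelmerDualData κ γ, D.mu = 0 :=
  Iff.rfl

/-- **Monotonicity: Greenberg's Conjecture 1.11 at `2` in its printed generality for irreducible `E[2]`** («`μ = 0` for every cyclotomic
dual datum of every elliptic `W/ℚ` with `E[2]` irreducible whose Selmer group is `Λ`-cotorsion» — displayed as a HYPOTHESIS, not defined)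
**implies G11⁻**, granted cotorsion on the cell (displayed HYPOTHESIS `htors`; in the doors file it is Kato 17.4 (1) at `2`, PUB).
[cite: GreenbergLNM1716, Conj. 1.11 (p. 64)] [cite: Kato2004Asterisque, Thm. 17.4 (1) (p. 273)] -/
theorem greenbergMuZeroTwoOrdNegDisc_of_conj111_two
    (h : ∀ (W : WeierstrassCurve ℚ) [W.IsElliptic], W.HasIrreducibleModPGaloisRep 2 →
      ∀ (κ : ZpExtension ℚ 2) (γ : absoluteGaloisGroup ℚ), κ.IsCyclotomic → κ.IsTopGenerator γ →
        ∀ D : W.SelmerDualData κ γ, D.IsTorsion → D.mu = 0)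
    (htors : ∀ (W : WeierstrassCurve ℚ) [W.IsElliptic] [W.IsGloballyMinimal], GoodOrd W 2 →
      ∀ (κ : ZpExtension ℚ 2) (γ : absoluteGaloisGroup ℚ), κ.IsCyclotomic → κ.IsTopGenerator γ → IsCyclotomicVariable 2 γ →
        ∀ D : W.SelmerDualData κ γ, D.IsTorsion) :
    GreenbergMuZeroTwoOrdNegDisc :=
  fun W _ _ hgo h2 _ κ γ hκ hγ hγ' D =>
    h W (hasIrreducibleModPGaloisRep_of_hasSurjectiveModNGaloisRep W 2 h2) κ γ hκ hγ D (htors W hgo κ γ hκ hγ hγ' D)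

/-- [MEMO, OPEN] **MU13⁻ — the `μ`-invariant of the zeta quotient `𝐇¹_Γ(T₂W) ⧸ Λz` vanishes for some GENUINE `2`-adic Euler-system class
`z`, on the `Δ < 0` cell of crux 202.** For every globally minimal `W/ℚ` with `Δ_W < 0`, good ordinary at `2`, `ρ̄_{W,2}` onto (the
structure facts of `T₂W` as instance BINDERS), every cyclotomic `ℤ₂`-extension `κ` with a normalised topological generator `γ` matching the
cyclotomic variable, and EVERY pinned carrier `I = 𝐇¹_Γ(T₂W)` (`IwasawaH1Data`): there is `z ∈ 𝐇¹_Γ` which is the Λ-adic class of a GENUINE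
integral Euler system for `T₂W` (`IsEulerSystemClassTwo`, Kato §13.1 / Ex. 13.3 at `p = 2`) with `𝐇¹_Γ ⧸ Λz` finitely generated over `ℤ₂`
(`μ(𝐇¹_Γ/Λz) = 0`: `𝐇¹_Γ` is torsion-free of rank `1`, Kato Thm. 12.4 (2), so the quotient is torsion). The `μ`-part of Kato's term
`𝐇¹(T)/Z(f,T)` in the §17.13 identity (p. 280, printed at `𝔭 = (p)` only for `p ≠ 2` under (12.5.2)); INTERNAL to the Euler system in Iwasawa
cohomology (no Coleman map, pairing, `L`-function or functional). MEMO tier: NOT in print as stated at `p = 2`; the exact excess of the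
registered stub V♭⁻ over G11⁻ (doors file). Junk excluded: `z = 0` gives `𝐇¹_Γ ⧸ 0 ≅ 𝐇¹_Γ`, not finitely generated over `ℤ₂` once `𝐇¹_Γ ≠ 0`.
Nothing asserted. [cite: Kato2004Asterisque, Thm. 12.4 (2) (p. 221), §13.1 (13.1.1) and Thm. 13.4 (pp. 224–226), §17.13 (pp. 279–280)] -/
@[conjecture] def ZetaQuotientMuZeroTwoOrdNegDisc : Prop :=
  ∀ (W : WeierstrassCurve ℚ) [W.IsElliptic] [W.IsGloballyMinimal]
      [ContinuousSMul ℤ_[2] (W.tateModule 2)] [Module.Free ℤ_[2] (W.tateModule 2)] [Module.Finite ℤ_[2] (W.tateModule 2)]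
      (κ : ZpExtension ℚ 2) (γ : absoluteGaloisGroup ℚ) (hκ : κ.IsCyclotomic),
      κ.IsTopGenerator γ → W.Δ < 0 → IsOrdinaryAt W 2 → W.HasSurjectiveModNGaloisRep 2 → IsCyclotomicVariable 2 γ →
      ∀ I : IwasawaH1Data W 2 κ γ,
        ∃ z : I.H, IsEulerSystemClassTwo W hκ I z ∧
          Module.Finite ℤ_[2] (RestrictScalars ℤ_[2] (IwasawaAlgebra 2) (I.H ⧸ (IwasawaAlgebra 2) ∙ z))

/-- `ZetaQuotientMuZeroTwoOrdNegDisc` unfolds to its displayed body. [folklore] -/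
theorem zetaQuotientMuZeroTwoOrdNegDisc_iff : ZetaQuotientMuZeroTwoOrdNegDisc ↔
    ∀ (W : WeierstrassCurve ℚ) [W.IsElliptic] [W.IsGloballyMinimal]
      [ContinuousSMul ℤ_[2] (W.tateModule 2)] [Module.Free ℤ_[2] (W.tateModule 2)] [Module.Finite ℤ_[2] (W.tateModule 2)]
      (κ : ZpExtension ℚ 2) (γ : absoluteGaloisGroup ℚ) (hκ : κ.IsCyclotomic),
      κ.IsTopGenerator γ → W.Δ < 0 → IsOrdinaryAt W 2 → W.HasSurjectiveModNGaloisRep 2 → IsCyclotomicVariable 2 γ →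
      ∀ I : IwasawaH1Data W 2 κ γ,
        ∃ z : I.H, IsEulerSystemClassTwo W hκ I z ∧
          Module.Finite ℤ_[2] (RestrictScalars ℤ_[2] (IwasawaAlgebra 2) (I.H ⧸ (IwasawaAlgebra 2) ∙ z)) :=
  Iff.rfl

/-- [MEMO, OPEN] **N2D⁻ — Kato's `2`-adic Euler system is NOT `2`-DIVISIBLE in `𝐇¹_Γ(T₂W)` on the `Δ < 0` cell of crux 202** (appended, g7).
For every globally minimal `W/ℚ` with `Δ_W < 0`, good ordinary at `2`, `ρ̄_{W,2}` onto, every cyclotomic `ℤ₂`-extension `κ` with a normalised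
topological generator `γ` matching the cyclotomic variable, and EVERY pinned carrier `I = 𝐇¹_Γ(T₂W)`: some GENUINE `2`-adic Euler-system class
`z ∈ 𝐇¹_Γ` (`IsEulerSystemClassTwo`) does NOT lie in `(2)·𝐇¹_Γ` — the binder-for-binder NEGATION, at every curve of the cell, of the
`2`-divisibility hypothesis `hdiv` of the disprover's Negative lemma p691215 (`…OrdKatoHalfAtTwoIso/Negative/ZetaColemanMuTwoDivisible`,
`zetaColemanMuInputsAtTwo_false_of_twoDivisible`). Granted Kato Thm. 12.4 (2) (`thm12_4`, rank clause, print every `p`) it is EQUIVALENT to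
MU13⁻ `ZetaQuotientMuZeroTwoOrdNegDisc` in the kernel (w3 g7: `𝐇¹_Γ(T₂W)` is Λ-FREE when `W[2]` is irreducible — Kato Thm. 12.4 (3) at
`p = 2`, a tree THEOREM `IwasawaH1Data.moduleFree_of_hasIrreducibleModPGaloisRep` — and on `Λ·e`, `μ(Λe/Λz) = 0 ⟺ z ∉ 2Λe`); so V♭⁻ ⟺ G11⁻ ∧ N2D⁻
mod print. Where it should come from: the lead's F-27a («`c_∞ = 1` on `Δ < 0`: `γ₁^∨` booked exactly, `‖r‖₂ = 1» — rhombic period lattice);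
MEMO tier, NOT in print as stated at `p = 2`; nothing asserted. Junk: `z = 0 ∈ (2)·𝐇¹_Γ` is excluded by the statement itself.
[cite: Kato2004Asterisque, Thm. 12.4 (2)(3) (p. 221), Thm. 12.6 (p. 222), §13.1 (13.1.1) and Thm. 13.4 (pp. 224–226), §13.8 (pp. 228–229)] -/
@[conjecture] def ZetaNotTwoDivisibleTwoOrdNegDisc : Prop :=
  ∀ (W : WeierstrassCurve ℚ) [W.IsElliptic] [W.IsGloballyMinimal]
      [ContinuousSMul ℤ_[2] (W.tateModule 2)] [Module.Free ℤ_[2] (W.tateModule 2)] [Module.Finite ℤ_[2] (W.tateModule 2)]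
      (κ : ZpExtension ℚ 2) (γ : absoluteGaloisGroup ℚ) (hκ : κ.IsCyclotomic),
      κ.IsTopGenerator γ → W.Δ < 0 → IsOrdinaryAt W 2 → W.HasSurjectiveModNGaloisRep 2 → IsCyclotomicVariable 2 γ →
      ∀ I : IwasawaH1Data W 2 κ γ,
        ∃ z : I.H, IsEulerSystemClassTwo W hκ I z ∧
          z ∉ IwasawaAlgebra.augIdealP 2 • (⊤ : Submodule (IwasawaAlgebra 2) I.H)

/-- `ZetaNotTwoDivisibleTwoOrdNegDisc` unfolds to its displayed body. [folklore] -/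
theorem zetaNotTwoDivisibleTwoOrdNegDisc_iff : ZetaNotTwoDivisibleTwoOrdNegDisc ↔
    ∀ (W : WeierstrassCurve ℚ) [W.IsElliptic] [W.IsGloballyMinimal]
      [ContinuousSMul ℤ_[2] (W.tateModule 2)] [Module.Free ℤ_[2] (W.tateModule 2)] [Module.Finite ℤ_[2] (W.tateModule 2)]
      (κ : ZpExtension ℚ 2) (γ : absoluteGaloisGroup ℚ) (hκ : κ.IsCyclotomic),
      κ.IsTopGenerator γ → W.Δ < 0 → IsOrdinaryAt W 2 → W.HasSurjectiveModNGaloisRep 2 → IsCyclotomicVariable 2 γ →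
      ∀ I : IwasawaH1Data W 2 κ γ,
        ∃ z : I.H, IsEulerSystemClassTwo W hκ I z ∧
          z ∉ IwasawaAlgebra.augIdealP 2 • (⊤ : Submodule (IwasawaAlgebra 2) I.H) :=
  Iff.rfl

end Summit.BirchSwinnertonDyer.BirchSwinnertonDyer.Theorems.SteinbergFibreAtTwo

end
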